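import Mathlib
import Literature.NumberTheory.Irrationality.Zudilin2003.CatalanRemarks
import Summits.KontsevichZagierPeriods.Zeta5Search.Zudilin2003ExactRates
import HarnessLib

/-!
# Zudilin's "remarks" note, Theorem 2 — the growth of `ũ_n`, `ṽ_n`: ratio limit and exact rate `log ũ_n / n → log ((1+√5)/2)⁵`

[Zudilin2002CatalanRemarks, Sect. 2, Theorem 2]: the solutions `ũ_n` (`uT`) and `ṽ_n` (`vT`) of the second
Apéry-like recursion (13) satisfy `lim ũ_n^{1/n} = ((1+√5)/2)⁵ = (11+5√5)/2 = exp(2.40605912…)` — the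
conjunct (ii′) of the tree's named fact `Zudilin2003.remarksTheorem2`.  This file proves the exact ratio limit and
the exact rate `log ũ_n / n → log ((1+√5)/2)⁵` (from which (ii′) is one line, see below), by the tree's
own engine for the 2003 recursion (`Zudilin2003Growth`, `RecurrenceGrowth`, the Poincaré ratio theorem
`Literature.Analysis.Asymptotics.PoincareRecurrence.tendsto_ratio_of_recurrence₂`), transplanted to (13):

* (13) at `n = m + 1` in solved form is `x_{m+2} = s̃_m x_{m+1} − t̃_m x_m` with
  `s̃_m = q̃(m+1)/L̃_m`, `t̃_m = −(2m+2)²(2m+3)(2m−1)p̃(m+2)/L̃_m`, `L̃_m = (2m+2)²(2m+3)²p̃(m+1)`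
  (`sT13`, `tT13`, `lead13`, `num13`; `solTR_rec`); `s̃_m → 11`, `t̃_m → −1` (`tendsto_sT13`, `tendsto_tT13`),
  so the characteristic equation is again `λ² = 11λ + 1` with dominant root `((1+√5)/2)⁵` (`golden_fifth`);
* `t̃_m ≤ 0` for `m ≥ 1`, and the ratio box `[19/2, 56/5]` is invariant from `m = 1` on (corner inequalities
  `corner_low13`, `corner_up13`: cleared, they are degree-6 polynomials in `m − 1` with nonnegative integer
  coefficients); with `ũ₁ = 6`, `ũ₂ = 115/2`, `ṽ₁ = 5`, `ṽ₂ = 1897/36` this certifies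
  `0 < ũ_n`, `(19/2) ũ_n ≤ ũ_{n+1} ≤ (56/5) ũ_n` and the same for `ṽ_n`, for every `n ≥ 1`
  (`ratio_bounds_uT`, `ratio_bounds_vT`);
* Poincaré (`|−1| < (19/2)²`): `ũ_{n+1}/ũ_n → ((1+√5)/2)⁵` (`tendsto_ratio_uT`), hence
  **`log ũ_n / n → log ((1+√5)/2)⁵`** (`tendsto_log_uT_div`); the same for `ṽ_n` (`tendsto_ratio_vT`,
  `tendsto_log_vT_div`).  The verbatim conjunct (ii′) `ũ_n^{1/n} → ((1+√5)/2)⁵` is `tendsto_log_uT_div` composed with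
  `Zudilin2003Growth.tendsto_root_of_tendsto_log_div` (and `uTR_pos`); it is not restated as a stand-alone
  declaration here — it is assembled where it is consumed, in `CatalanRemarksTLimit.remarksTheorem2_holds`
  (read it off as `remarksTheorem2_holds.2.2.1`).

HONEST FRAMING: systematic search; no irrationality claim unless certified.  Nothing here bears on the
irrationality of Catalan's constant; the decay clause (ii) of `remarksTheorem2` is not touched in this file.
-/

open Filter Topology
open Literature.NumberTheory.Irrationality.Zudilin2003
open Literature.Analysis.Asymptotics.PoincareRecurrence
open Summit.KontsevichZagierPeriods.Zeta5Search.Zudilin2003Growth (golden_fifth two_lt_sqrt_five)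

namespace Summit.KontsevichZagierPeriods.Zeta5Search.CatalanRemarksVT

/-! ### (13) in solved form over `ℝ` -/

/-- `ũ_n` as a real sequence. [cite: Zudilin2002CatalanRemarks, Sect. 2, Theorem 2] -/
def uTR (n : ℕ) : ℝ := ((uT n : ℚ) : ℝ)

/-- `ṽ_n` as a real sequence. [cite: Zudilin2002CatalanRemarks, Sect. 2, Theorem 2] -/
def vTR (n : ℕ) : ℝ := ((vT n : ℚ) : ℝ)

/-- The leading coefficient of (13) at `n = m + 1`: `L̃_m = (2m+2)²(2m+3)² p̃(m+1) = (2m+2)²(2m+3)²(20m²+20m+3)`.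
[cite: Zudilin2002CatalanRemarks, Sect. 2, eq. (13)] -/
def lead13 (m : ℕ) : ℝ :=
  (2 * (m : ℝ) + 2) ^ 2 * (2 * (m : ℝ) + 3) ^ 2 * (20 * (m : ℝ) ^ 2 + 20 * m + 3)

/-- The numerator of the last coefficient of (13) at `n = m + 1`:
`(2m+2)²(2m+3)(2m−1) p̃(m+2) = (2m+2)²(2m+3)(2m−1)(20m²+60m+43)`. [cite: Zudilin2002CatalanRemarks, Sect. 2, eq. (13)] -/
def num13 (m : ℕ) : ℝ :=
  (2 * (m : ℝ) + 2) ^ 2 * (2 * (m : ℝ) + 3) * (2 * (m : ℝ) - 1) * (20 * (m : ℝ) ^ 2 + 60 * m + 43)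

/-- `s̃_m = q̃(m+1)/L̃_m`. [cite: Zudilin2002CatalanRemarks, Sect. 2, eq. (13)] -/
noncomputable def sT13 (m : ℕ) : ℝ := qT ((m : ℝ) + 1) / lead13 m

/-- `t̃_m = −(2m+2)²(2m+3)(2m−1) p̃(m+2)/L̃_m` (nonpositive for `m ≥ 1`). [cite: Zudilin2002CatalanRemarks, Sect. 2, eq. (13)] -/
noncomputable def tT13 (m : ℕ) : ℝ := -num13 m / lead13 m

/-- `L̃_m > 0`. [cite: Zudilin2002CatalanRemarks, Sect. 2, eq. (13)] -/
theorem lead13_pos (m : ℕ) : 0 < lead13 m := by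
  unfold lead13; positivity

/-- The numerator of `−t̃_m` is nonnegative for `m ≥ 1`. [cite: Zudilin2002CatalanRemarks, Sect. 2, eq. (13)] -/
theorem num13_nonneg (m : ℕ) (hm : 1 ≤ m) : 0 ≤ num13 m := by
  have h1 : (1 : ℝ) ≤ m := by exact_mod_cast hm
  unfold num13
  exact mul_nonneg (mul_nonneg (by positivity) (by linarith)) (by positivity)

/-- `t̃_m ≤ 0` for `m ≥ 1` (the characteristic polynomial `λ² − 11λ − 1` has roots of opposite signs).
[cite: Zudilin2002CatalanRemarks, Sect. 2, eq. (13)] -/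
theorem tT13_nonpos (m : ℕ) (hm : 1 ≤ m) : tT13 m ≤ 0 := by
  have hL := lead13_pos m
  have hN := num13_nonneg m hm
  unfold tT13
  exact div_nonpos_of_nonpos_of_nonneg (by linarith) hL.le

/-- Every solution of (13), cast to `ℝ`, satisfies the solved form `x_{m+2} = s̃_m x_{m+1} − t̃_m x_m`.
[cite: Zudilin2002CatalanRemarks, Sect. 2, eq. (13)] -/
theorem solTR_rec (x₀ x₁ : ℚ) (m : ℕ) :
    ((solT x₀ x₁ (m + 2) : ℚ) : ℝ) = sT13 m * (solT x₀ x₁ (m + 1) : ℝ) - tT13 m * (solT x₀ x₁ m : ℝ) := by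
  have hL : lead13 m ≠ 0 := (lead13_pos m).ne'
  have h' := congrArg (fun x : ℚ => (x : ℝ)) (solT_step x₀ x₁ m)
  simp only [stepT, pT, qT] at h'
  push_cast at h'
  have hA : (2 * ((m : ℝ) + 1)) ^ 2 * (2 * ((m : ℝ) + 1) + 1) ^ 2 *
      (20 * ((m : ℝ) + 1) ^ 2 - 20 * ((m : ℝ) + 1) + 3) = lead13 m := by
    unfold lead13; ring
  rw [hA] at h'
  have e : sT13 m * (solT x₀ x₁ (m + 1) : ℝ) - tT13 m * (solT x₀ x₁ m : ℝ) =
      (qT ((m : ℝ) + 1) * (solT x₀ x₁ (m + 1) : ℝ) + num13 m * (solT x₀ x₁ m : ℝ)) / lead13 m := by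
    unfold sT13 tT13; rw [eq_div_iff hL]; field_simp; ring
  rw [e, h']
  congr 1
  unfold num13; simp only [qT]; ring

/-- `ũ_{m+2} = s̃_m ũ_{m+1} − t̃_m ũ_m`. [cite: Zudilin2002CatalanRemarks, Sect. 2, eq. (13)] -/
theorem uTR_rec (m : ℕ) : uTR (m + 2) = sT13 m * uTR (m + 1) - tT13 m * uTR m := by
  unfold uTR uT; exact solTR_rec 0 6 m

/-- `ṽ_{m+2} = s̃_m ṽ_{m+1} − t̃_m ṽ_m`. [cite: Zudilin2002CatalanRemarks, Sect. 2, eq. (13)] -/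
theorem vTR_rec (m : ℕ) : vTR (m + 2) = sT13 m * vTR (m + 1) - tT13 m * vTR m := by
  unfold vTR vT; exact solTR_rec (-1) 5 m

/-! ### Corner inequalities: the box `[19/2, 56/5]` is invariant from `m = 1` on -/

/-- Lower corner: `19/2 ≤ s̃_m − t̃_m/(56/5)` for `m ≥ 1` (cleared: a degree-6 polynomial in `k = m − 1`
with nonnegative integer coefficients). [cite: Zudilin2002CatalanRemarks, Sect. 2, eq. (13)] -/
theorem corner_low13 (m : ℕ) (hm : 1 ≤ m) : (19 / 2 : ℝ) ≤ sT13 m - tT13 m / (56 / 5) := by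
  obtain ⟨k, rfl⟩ : ∃ k, m = k + 1 := ⟨m - 1, by omega⟩
  have hL := lead13_pos (k + 1)
  have e : sT13 (k + 1) - tT13 (k + 1) / (56 / 5) =
      (56 * qT (((k + 1 : ℕ) : ℝ) + 1) + 5 * num13 (k + 1)) / (56 * lead13 (k + 1)) := by
    unfold sT13 tT13; field_simp; ring
  have hP : 2 * (56 * qT (((k + 1 : ℕ) : ℝ) + 1) + 5 * num13 (k + 1)) - 19 * (56 * lead13 (k + 1)) =
      2327536 + 8142560 * (k : ℝ) + 11463928 * (k : ℝ) ^ 2 + 8344000 * (k : ℝ) ^ 3 +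
        3317504 * (k : ℝ) ^ 4 + 683520 * (k : ℝ) ^ 5 + 56960 * (k : ℝ) ^ 6 := by
    unfold num13 lead13; simp only [qT]; push_cast; ring
  rw [e, le_div_iff₀ (by positivity)]
  have h0 : (0 : ℝ) ≤ 2 * (56 * qT (((k + 1 : ℕ) : ℝ) + 1) + 5 * num13 (k + 1)) -
      19 * (56 * lead13 (k + 1)) := by
    rw [hP]; positivity
  linarith

/-- Upper corner: `s̃_m − t̃_m/(19/2) ≤ 56/5` for `m ≥ 1`. [cite: Zudilin2002CatalanRemarks, Sect. 2, eq. (13)] -/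
theorem corner_up13 (m : ℕ) (hm : 1 ≤ m) : sT13 m - tT13 m / (19 / 2) ≤ (56 / 5 : ℝ) := by
  obtain ⟨k, rfl⟩ : ∃ k, m = k + 1 := ⟨m - 1, by omega⟩
  have hL := lead13_pos (k + 1)
  have e : sT13 (k + 1) - tT13 (k + 1) / (19 / 2) =
      (19 * qT (((k + 1 : ℕ) : ℝ) + 1) + 2 * num13 (k + 1)) / (19 * lead13 (k + 1)) := by
    unfold sT13 tT13; field_simp; ring
  have hP : 5 * ((56 / 5) * (19 * lead13 (k + 1))) -
      5 * (19 * qT (((k + 1 : ℕ) : ℝ) + 1) + 2 * num13 (k + 1)) =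
      788615 + 1906480 * (k : ℝ) + 1810828 * (k : ℝ) ^ 2 + 867008 * (k : ℝ) ^ 3 +
        227472 * (k : ℝ) ^ 4 + 34560 * (k : ℝ) ^ 5 + 2880 * (k : ℝ) ^ 6 := by
    unfold num13 lead13; simp only [qT]; push_cast; ring
  rw [e, div_le_iff₀ (by positivity)]
  have h0 : (0 : ℝ) ≤ 5 * ((56 / 5) * (19 * lead13 (k + 1))) -
      5 * (19 * qT (((k + 1 : ℕ) : ℝ) + 1) + 2 * num13 (k + 1)) := by
    rw [hP]; positivity
  linarith

/-! ### The certified brackets for `ũ_n` and `ṽ_n` -/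

/-- `ũ₃ = 19719/32`. [cite: Zudilin2002CatalanRemarks, Sect. 2, eq. (13)] -/
theorem uT_three : uT 3 = 19719 / 32 := by
  have h : uT 3 = stepT 1 (uT 1) (uT 2) := solT_step 0 6 1
  rw [h, uT_two]; unfold uT; rw [solT_one]; norm_num [stepT, pT, qT]

/-- `ṽ₃ = 903093/1600`. [cite: Zudilin2002CatalanRemarks, Sect. 2, eq. (13)] -/
theorem vT_three : vT 3 = 903093 / 1600 := by
  have h : vT 3 = stepT 1 (vT 1) (vT 2) := solT_step (-1) 5 1
  rw [h, vT_two]; unfold vT; rw [solT_one]; norm_num [stepT, pT, qT]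

/-- **Kernel-certified ratio bracket for `ũ_n`.** For every `n ≥ 1`: `ũ_n > 0` and
`(19/2) ũ_n ≤ ũ_{n+1} ≤ (56/5) ũ_n`. [cite: Zudilin2002CatalanRemarks, Sect. 2, Theorem 2] -/
theorem ratio_bounds_uT :
    ∀ n, 1 ≤ n → 0 < uTR n ∧ 19 / 2 * uTR n ≤ uTR (n + 1) ∧ uTR (n + 1) ≤ 56 / 5 * uTR n := by
  refine ratio_bounds_of_recurrence_neg uTR sT13 tT13 1 (fun m _ => uTR_rec m) (fun m hm => tT13_nonpos m hm)
    (by norm_num) (by norm_num) (fun m hm => corner_low13 m hm) (fun m hm => corner_up13 m hm) ?_ ?_ ?_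
  · unfold uTR uT; rw [solT_one]; norm_num
  · show 19 / 2 * uTR 1 ≤ uTR 2
    unfold uTR; rw [uT_two]; unfold uT; rw [solT_one]; norm_num
  · show uTR 2 ≤ 56 / 5 * uTR 1
    unfold uTR; rw [uT_two]; unfold uT; rw [solT_one]; norm_num

/-- **Kernel-certified ratio bracket for `ṽ_n`.** For every `n ≥ 1`: `ṽ_n > 0` and
`(19/2) ṽ_n ≤ ṽ_{n+1} ≤ (56/5) ṽ_n`. [cite: Zudilin2002CatalanRemarks, Sect. 2, Theorem 2] -/
theorem ratio_bounds_vT :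
    ∀ n, 1 ≤ n → 0 < vTR n ∧ 19 / 2 * vTR n ≤ vTR (n + 1) ∧ vTR (n + 1) ≤ 56 / 5 * vTR n := by
  refine ratio_bounds_of_recurrence_neg vTR sT13 tT13 1 (fun m _ => vTR_rec m) (fun m hm => tT13_nonpos m hm)
    (by norm_num) (by norm_num) (fun m hm => corner_low13 m hm) (fun m hm => corner_up13 m hm) ?_ ?_ ?_
  · unfold vTR vT; rw [solT_one]; norm_num
  · show 19 / 2 * vTR 1 ≤ vTR 2
    unfold vTR; rw [vT_two]; unfold vT; rw [solT_one]; norm_num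
  · show vTR 2 ≤ 56 / 5 * vTR 1
    unfold vTR; rw [vT_two]; unfold vT; rw [solT_one]; norm_num

/-- `ũ_n > 0` for `n ≥ 1` (`ũ₀ = 0`). [cite: Zudilin2002CatalanRemarks, Sect. 2, Theorem 2] -/
theorem uTR_pos (n : ℕ) (hn : 1 ≤ n) : 0 < uTR n := (ratio_bounds_uT n hn).1

/-- `ṽ_n > 0` for `n ≥ 1` (`ṽ₀ = −1`). [cite: Zudilin2002CatalanRemarks, Sect. 2, Theorem 2] -/
theorem vTR_pos (n : ℕ) (hn : 1 ≤ n) : 0 < vTR n := (ratio_bounds_vT n hn).1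

/-! ### Coefficient limits `s̃_m → 11`, `t̃_m → −1` -/

/-- `1/(m+1) → 0`. [folklore] -/
private theorem tendsto_inv_succ13 : Tendsto (fun m : ℕ => (1 : ℝ) / ((m : ℝ) + 1)) atTop (𝓝 0) :=
  tendsto_one_div_add_atTop_nhds_zero_nat

/-- **`s̃_m → 11`** (leading coefficients `3520/320`). [cite: Zudilin2002CatalanRemarks, Sect. 2, eq. (13)] -/
theorem tendsto_sT13 : Tendsto sT13 atTop (𝓝 11) := by
  set F : ℝ → ℝ := fun y => 3520 - 2672 * y ^ 2 + 196 * y ^ 4 - 9 * y ^ 6 with hF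
  set G : ℝ → ℝ := fun y => 4 * (2 + y) ^ 2 * (20 - 20 * y + 3 * y ^ 2) with hG
  have hGpos : ∀ m : ℕ, 0 < G (1 / ((m : ℝ) + 1)) := by
    intro m
    have hm : (m : ℝ) + 1 ≠ 0 := by positivity
    have e : G (1 / ((m : ℝ) + 1)) = lead13 m / ((m : ℝ) + 1) ^ 6 := by
      rw [hG]; unfold lead13; field_simp; ring
    rw [e]; exact div_pos (lead13_pos m) (by positivity)
  have hseq : ∀ m : ℕ, sT13 m = F (1 / ((m : ℝ) + 1)) / G (1 / ((m : ℝ) + 1)) := by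
    intro m
    have hm : (m : ℝ) + 1 ≠ 0 := by positivity
    have h2 : 2 * (m : ℝ) + 2 ≠ 0 := by positivity
    have h3 : 2 * (m : ℝ) + 3 ≠ 0 := by positivity
    have hp : 20 * (m : ℝ) ^ 2 + 20 * m + 3 ≠ 0 := by positivity
    rw [eq_div_iff (hGpos m).ne']
    unfold sT13 lead13
    rw [hF, hG]
    simp only [qT]
    field_simp
    ring
  have hFc : Continuous F := by rw [hF]; fun_prop
  have hGc : Continuous G := by rw [hG]; fun_prop
  have hF0 : Tendsto (fun m : ℕ => F (1 / ((m : ℝ) + 1))) atTop (𝓝 (F 0)) :=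
    (hFc.tendsto 0).comp tendsto_inv_succ13
  have hG0 : Tendsto (fun m : ℕ => G (1 / ((m : ℝ) + 1))) atTop (𝓝 (G 0)) :=
    (hGc.tendsto 0).comp tendsto_inv_succ13
  have hG0ne : G 0 ≠ 0 := by rw [hG]; norm_num
  have hlim : F 0 / G 0 = 11 := by rw [hF, hG]; norm_num
  rw [← hlim]
  exact (hF0.div hG0 hG0ne).congr fun m => (hseq m).symm

/-- **`t̃_m → −1`** (leading coefficients `−320/320`). [cite: Zudilin2002CatalanRemarks, Sect. 2, eq. (13)] -/
theorem tendsto_tT13 : Tendsto tT13 atTop (𝓝 (-1)) := by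
  set F : ℝ → ℝ := fun y => -(4 * (2 + y) * (2 - 3 * y) * (20 + 20 * y + 3 * y ^ 2)) with hF
  set G : ℝ → ℝ := fun y => 4 * (2 + y) ^ 2 * (20 - 20 * y + 3 * y ^ 2) with hG
  have hGpos : ∀ m : ℕ, 0 < G (1 / ((m : ℝ) + 1)) := by
    intro m
    have hm : (m : ℝ) + 1 ≠ 0 := by positivity
    have e : G (1 / ((m : ℝ) + 1)) = lead13 m / ((m : ℝ) + 1) ^ 6 := by
      rw [hG]; unfold lead13; field_simp; ring
    rw [e]; exact div_pos (lead13_pos m) (by positivity)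
  have hteq : ∀ m : ℕ, tT13 m = F (1 / ((m : ℝ) + 1)) / G (1 / ((m : ℝ) + 1)) := by
    intro m
    have hm : (m : ℝ) + 1 ≠ 0 := by positivity
    have h2 : 2 * (m : ℝ) + 2 ≠ 0 := by positivity
    have h3 : 2 * (m : ℝ) + 3 ≠ 0 := by positivity
    have hp : 20 * (m : ℝ) ^ 2 + 20 * m + 3 ≠ 0 := by positivity
    rw [eq_div_iff (hGpos m).ne']
    unfold tT13 num13 lead13
    rw [hF, hG]
    simp only
    field_simp
    ring
  have hFc : Continuous F := by rw [hF]; fun_prop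
  have hGc : Continuous G := by rw [hG]; fun_prop
  have hF0 : Tendsto (fun m : ℕ => F (1 / ((m : ℝ) + 1))) atTop (𝓝 (F 0)) :=
    (hFc.tendsto 0).comp tendsto_inv_succ13
  have hG0 : Tendsto (fun m : ℕ => G (1 / ((m : ℝ) + 1))) atTop (𝓝 (G 0)) :=
    (hGc.tendsto 0).comp tendsto_inv_succ13
  have hG0ne : G 0 ≠ 0 := by rw [hG]; norm_num
  have hlim : F 0 / G 0 = -1 := by rw [hF, hG]; norm_num
  rw [← hlim]
  exact (hF0.div hG0 hG0ne).congr fun m => (hteq m).symm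

/-! ### Poincaré: ratio limit and growth rate of any positive solution bracketed below by `19/2` -/

/-- **Poincaré's theorem applied to (13)**: a real solution `w` of (13) in solved form with `w_n > 0` and
`(19/2) w_n ≤ w_{n+1}` for `n ≥ 1` has `w_{n+1}/w_n → ((1+√5)/2)⁵` (contraction constant `|−1|/(19/2)² < 1`;
`(11+5√5)/2 ≥ 19/2`). [cite: Zudilin2002CatalanRemarks, Sect. 2, Theorem 2] -/
theorem tendsto_ratio_of_bracket13 (w : ℕ → ℝ)
    (hrec : ∀ m, w (m + 2) = sT13 m * w (m + 1) - tT13 m * w m)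
    (hbr : ∀ n, 1 ≤ n → 0 < w n ∧ 19 / 2 * w n ≤ w (n + 1)) :
    Tendsto (fun n => w (n + 1) / w n) atTop (𝓝 (((1 + Real.sqrt 5) / 2) ^ 5)) := by
  obtain ⟨hpow, hchar⟩ := golden_fifth
  rw [hpow]
  refine tendsto_ratio_of_recurrence₂ w sT13 tT13 (L := 19 / 2) 1 (fun m _ => hrec m) tendsto_sT13
    tendsto_tT13 (by norm_num) (fun n hn => (hbr n hn).1.ne') (fun n hn => ?_) hchar ?_ (by norm_num)
  · obtain ⟨hpos, hle⟩ := hbr n hn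
    rwa [le_div_iff₀ hpos]
  · linarith [two_lt_sqrt_five]

/-- **Rate from ratio** for such a solution: `log w_n / n → log ((1+√5)/2)⁵`.
[cite: Zudilin2002CatalanRemarks, Sect. 2, Theorem 2] -/
theorem tendsto_log_div_of_bracket13 (w : ℕ → ℝ)
    (hrec : ∀ m, w (m + 2) = sT13 m * w (m + 1) - tT13 m * w m)
    (hbr : ∀ n, 1 ≤ n → 0 < w n ∧ 19 / 2 * w n ≤ w (n + 1)) :
    Tendsto (fun n => Real.log (w n) / n) atTop (𝓝 (Real.log (((1 + Real.sqrt 5) / 2) ^ 5))) := by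
  have hl0 : (0 : ℝ) < ((1 + Real.sqrt 5) / 2) ^ 5 := by
    have := two_lt_sqrt_five; positivity
  have h := tendsto_log_abs_div_of_tendsto_ratio w 1 (fun n hn => (hbr n hn).1.ne') hl0.ne'
    (tendsto_ratio_of_bracket13 w hrec hbr)
  rw [abs_of_pos hl0] at h
  refine h.congr' ?_
  filter_upwards [eventually_ge_atTop 1] with n hn
  rw [abs_of_pos (hbr n hn).1]

/-! ### `ũ_n`, `ṽ_n`: ratio limits and exact rates -/

/-- **Exact ratio limit**: `ũ_{n+1}/ũ_n → ((1+√5)/2)⁵`. [cite: Zudilin2002CatalanRemarks, Sect. 2, Theorem 2] -/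
theorem tendsto_ratio_uT :
    Tendsto (fun n => uTR (n + 1) / uTR n) atTop (𝓝 (((1 + Real.sqrt 5) / 2) ^ 5)) :=
  tendsto_ratio_of_bracket13 uTR uTR_rec fun n hn => ⟨(ratio_bounds_uT n hn).1, (ratio_bounds_uT n hn).2.1⟩

/-- **Exact ratio limit**: `ṽ_{n+1}/ṽ_n → ((1+√5)/2)⁵`. [cite: Zudilin2002CatalanRemarks, Sect. 2, Theorem 2] -/
theorem tendsto_ratio_vT :
    Tendsto (fun n => vTR (n + 1) / vTR n) atTop (𝓝 (((1 + Real.sqrt 5) / 2) ^ 5)) :=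
  tendsto_ratio_of_bracket13 vTR vTR_rec fun n hn => ⟨(ratio_bounds_vT n hn).1, (ratio_bounds_vT n hn).2.1⟩

/-- **Exact growth rate of `ũ_n`**: `log ũ_n / n → log ((1+√5)/2)⁵ = 2.40605912…`.
[cite: Zudilin2002CatalanRemarks, Sect. 2, Theorem 2] -/
theorem tendsto_log_uT_div :
    Tendsto (fun n : ℕ => Real.log ((uT n : ℚ) : ℝ) / n) atTop
      (𝓝 (Real.log (((1 + Real.sqrt 5) / 2) ^ 5))) :=
  tendsto_log_div_of_bracket13 uTR uTR_rec fun n hn => ⟨(ratio_bounds_uT n hn).1, (ratio_bounds_uT n hn).2.1⟩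

/-- **Exact growth rate of `ṽ_n`**: `log ṽ_n / n → log ((1+√5)/2)⁵`. [cite: Zudilin2002CatalanRemarks, Sect. 2, Theorem 2] -/
theorem tendsto_log_vT_div :
    Tendsto (fun n : ℕ => Real.log ((vT n : ℚ) : ℝ) / n) atTop
      (𝓝 (Real.log (((1 + Real.sqrt 5) / 2) ^ 5))) :=
  tendsto_log_div_of_bracket13 vTR vTR_rec fun n hn => ⟨(ratio_bounds_vT n hn).1, (ratio_bounds_vT n hn).2.1⟩

end Summit.KontsevichZagierPeriods.Zeta5Search.CatalanRemarksVT
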